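import Summits.NavierStokesRegularity.NavierStokesRegularity.Theses.TautLoopKelvin
import Summits.NavierStokesRegularity.NavierStokesRegularity.Theorems.TautLoopKelvinTautLoopLawDiniSaks
import Summits.NavierStokesRegularity.NavierStokesRegularity.Theorems.TautLoopKelvinTautLoopLawRightLscTransfer
import Summits.NavierStokesRegularity.NavierStokesRegularity.Theorems.TautLoopKelvinTautLoopLawLevelLeftContinuity
import Summits.NavierStokesRegularity.NavierStokesRegularity.Theorems.TautLoopKelvinTautLoopLawSlabRegularity
import Summits.NavierStokesRegularity.NavierStokesRegularity.Theorems.TautLoopKelvinTautLoopLawViscousKelvin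
import Summits.NavierStokesRegularity.NavierStokesRegularity.Theorems.TautLoopKelvinTautLoopLawStepOfSelection
import Summits.NavierStokesRegularity.NavierStokesRegularity.Theorems.TautLoopKelvinTautLoopLawWalkSelection
import HarnessLib

/-!
# Route `TautLoopKelvin`, crux `TautLoopLaw` (stmt-NavierStokesRegularity-15249) — PROVED
# (line `Sketch-ideas-r1k1`, Dini–Saks architecture; assembly of 7 skeleton stubs + 21 tools stubs)

THEOREM L (integrated robust form): for a classical Leray–Hopf solution from a rapidly decaying datum
on `[0,T)`, a level `g > 0`, times `0 ≤ t₁ ≤ t₂ < T` and a measurable majorant `Φ` of the near-taut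
compression rate `Λ_g` on `(t₁,t₂)` with `∫ Φ⁺ ≤ M`: `ℓ(g,t₁) · e^{-M} ≤ ℓ(g,t₂)` in `[0,∞]`, where
`ℓ(g,t) = inf {length C : C a closed C¹ loop, |∮_C u(t)·dl| ≥ g}` (`inf ∅ = ⊤`).

LINE (cards `dini-saks-semicontinuity` + `random-walk-kelvin-selection` / `translation-max-drain`,
ideator 1, round 1). The crux is cut into statements each living at ONE base time, glued by a
Saks-type real-induction lemma in `[0,∞]`:

* `stub_tautLoopDiniSaks` — PURE REAL ANALYSIS (provable now): if `f : ℝ → [0,∞]` is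
  right-lower-semicontinuous on `[a,b)` and satisfies the left-Dini step
  `f(t-h) ≤ f(t)·exp(h(Λ(t)+η))` (all `η > 0`, all small `h > 0`) at every `t ∈ (a,b]`, and `Λ ≤ Φ` on
  `(a,b)` with `Φ` measurable, `∫⁻_{(a,b)} Φ⁺ ≤ M`, then `f(a)·e^{-M} ≤ f(b)` (backward real induction on
  `{s : f s ≤ f b · exp(∫_s^b Ψ + η(b-s) + η)}` with an lsc Vitali–Carathéodory majorant `Ψ > Φ⁺`,
  Mathlib `exists_lt_lowerSemicontinuous_lintegral_ge`; closed under decreasing limits by right-lsc,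
  open to the left by the step + lsc of `Ψ`; the extra `η` absorbs the uncontrolled `Λ(b)`).
* `stub_tautLoopRightLscTransfer` — PURE (provable now): right-lsc of `s ↦ ℓ(u s, g)` at `t` follows from
  sup-norm right-continuity of `s ↦ u s` at `t` and level-left-continuity of `g' ↦ ℓ(u t, g')` at `g`
  (a near-optimal loop at time `s` is admissible at time `t` at level `g - κ·len`; `k`-fold covers handle
  the empty class).
* `stub_tautLoopLevelLeftContinuity` — STATIC GEOMETRY of one `C²` field decaying at infinity (provable,
  heavy): `ℓ(v,g) ≤ sup_{g'<g} ℓ(v,g')` at a nonempty level (confinement + Arzelà–Ascoli of constant-speed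
  near-optimal loops + continuity of `Γ` under uniform convergence with bounded lengths (integration by
  parts, `‖∇v‖_∞`) + periodic mollification + exact-level repair: homotopy invariance where `curl v = 0`
  near the limit loop, else a many-windings lasso at a nearby point with `curl v ≠ 0`, cost
  `2d + O(√(δ/|ω|)) → 0`).
* `stub_tautLoopSlabRegularity` — NS REGULARITY WIRING (classical facts, in-tree: Leray's local regular
  solutions `leray_local_regular_H1_holds`, weak–strong uniqueness `serrin_weak_strong_uniqueness_holds`,
  Tao 2011 Cor. 11.1/11.4 `tao2011_boundedEnstrophy_holds` / `tao_unconditional_uniqueness_velocity_holds`):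
  every slice `u t`, `t ∈ [0,T)`, tends to `0` at spatial infinity, and `s ↦ u s` is sup-norm
  right-continuous at every `t ∈ [0,T)`.
* `stub_tautLoopViscousKelvin` — KELVIN WITH VISCOSITY along material loops (Majda–Bertozzi (1.61);
  LANDED p163926; a supports-helper of the crux, no longer consumed by the composition after the v3
  reshape: the random-walk route uses only the static Weber–Kelvin pull-back identity).
* v3 RESHAPE (2026-08-17, after wave 1 landed stubs 1–5): the exact-level step `stub_tautLoopExactLevelStep`
  is cut into `stub_tautLoopWalkSelection` (6A, classical XL: pull-back of ANY confined bounded-length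
  loop from `t` to `t-h` with length factor `exp(h(κ+δ))` and a super-exponentially small circulation
  deficit, by the finite 6-point random-walk Kelvin splitting + first-moment selection) and
  `stub_tautLoopStepOfSelection` (6B, L: junk guards on the literal `Λ`, confinement of near-taut loops,
  analyticity-fed micro-lasso at `t-h`, exp-algebra), composed as 6B 6A.
* `tautLoopKelvin_tautLoopLaw_proof : TautLoopLaw` — the crux BY NAME: `DiniSaks` with `f s := ℓ(u s, g)`,
  `Λ s := Λ_g(s)` (the crux's literal `⨅ ε, sSup` expression), right-lsc on `[t₁,t₂)` from
  Transfer ∘ (SlabRegularity, LevelLeftContinuity), the step on `(t₁,t₂]` from StepFromSelection ∘ RandomWalkSelection (v3).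

Disproof used: none exists for this crux on 2026-08-17 (`ledger crux ls`: Ideas ×5, Lines/birth.* only;
payload disproof_path not materialised). Versus the registered birth line (`Lines/birth.lean`, not dead):
its `stub_finiteRelaxedLaw` (conclusion at relaxed levels `g' < g`) is implied by the crux but its sketched
proof needs `Λ_{g'}` at levels the hypothesis does not control (cards path-space / dini-saks); here the
level is exact at every step and level-left-continuity is used only at single times inside right-lsc.
-/

set_option linter.dupNamespace false

noncomputable section

open Literature.Analysis.FluidPDE MeasureTheory Set Function Filter
open scoped ENNReal NNReal Topology InnerProductSpace RealInnerProductSpace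

namespace Summit.NavierStokesRegularity.NavierStokesRegularity.Theorems

/-! ## Status: ALL STUBS LANDED (2026-08-17)

Wave 1: `stub_tautLoopDiniSaks` (p160146), `stub_tautLoopRightLscTransfer` (p160493), `stub_tautLoopLevelLeftContinuity`
(p162655; tools p161746 p162025 p162361), `stub_tautLoopSlabRegularity` (p163294), `stub_tautLoopViscousKelvin` (p163926).
Waves 2–4 (tools for the exact-level step): Spectrum p165634, Weber p166217, SixPoint p166863, WalkTail p167445,
VanishingOrder p168220 (+p168121), FlowTaylor p168912 (+p168766), FlowExists p169118, OneStep p169908 (+p169695),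
SlabDeluxe p170248, SliceAnalytic p170393, LassoQuant p170549, ImageLength p170613, OpProduct p170699,
IrrotationalRest p170812, Splitting p171400, SchemeCirc p171505, Composite p171591, LoopSide p171648;
skeleton stubs 6B `stub_tautLoopStepOfSelection` (p171263 + p171036) and 6A `stub_tautLoopWalkSelection`
(p172366 + p171884 p171888 p171929 p172160). All in `namespace Summit.NavierStokesRegularity.NavierStokesRegularity.Theorems`. -/

/-! ## The composition: the crux BY NAME from the stubs (real proof) -/

/-- Notation (proof-side only): `ℓ⟦v, g⟧` = the circulation–length spectrum of the field `v` at level `g`, in `ℝ≥0∞`. -/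
local notation3 "ℓ⟦" v ", " g "⟧" => (⨅ (γ' : ℝ → EuclideanSpace ℝ (Fin 3)) (_ : Literature.Analysis.FluidPDE.IsC1Loop γ' ∧ g ≤ |Literature.Analysis.FluidPDE.circulation v γ'|), ENNReal.ofReal (∫ σ in (0:ℝ)..1, ‖deriv γ' σ‖))

/-- Notation (proof-side only): `Λ⟦v, g⟧` = the crux's near-taut compression rate of `v` at level `g`. -/
local notation3 "Λ⟦" v ", " g "⟧" => (⨅ ε : {ε : ℝ // 0 < ε}, sSup {k : ℝ | ∃ γ : ℝ → EuclideanSpace ℝ (Fin 3), Literature.Analysis.FluidPDE.IsC1Loop γ ∧ g ≤ |Literature.Analysis.FluidPDE.circulation v γ| ∧ ENNReal.ofReal (∫ σ in (0:ℝ)..1, ‖deriv γ σ‖) ≤ ℓ⟦v, g⟧ + ENNReal.ofReal (ε : ℝ) ∧ k = ((∫ σ in (0:ℝ)..1, -(inner ℝ (deriv γ σ) (fderiv ℝ v (γ σ) (deriv γ σ))) / ‖deriv γ σ‖) / (∫ σ in (0:ℝ)..1, ‖deriv γ σ‖))})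

/-- **`TautLoopLaw` holds (route `TautLoopKelvin`, crux stmt-NavierStokesRegularity-15249): THEOREM L, integrated
robust form** — for a classical Leray–Hopf solution from a rapidly decaying datum on `[0,T)`, a level `g > 0`,
times `0 ≤ t₁ ≤ t₂ < T` and a measurable majorant `Φ` of the near-taut compression rate on `(t₁,t₂)` with
`∫⁻ Φ⁺ ≤ M`, the circulation–length spectrum obeys `ℓ(g,t₁)·e^{-M} ≤ ℓ(g,t₂)` in `[0,∞]`. Composition of the
landed stubs of line Sketch-ideas-r1k1 (Dini–Saks architecture): `DiniSaks` with
`f s := ℓ(u s, g)` and `Λ s := Λ_g(s)`; right-lsc on `[t₁,t₂)` from the transfer stub fed by slab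
regularity (continuity of slices, sup-norm right-continuity, decay) and static level-left-continuity;
the left-Dini step on `(t₁,t₂]` from the exact-level step = StepFromSelection fed by RandomWalkSelection. -/
theorem tautLoopKelvin_tautLoopLaw_proof :
    Summit.NavierStokesRegularity.NavierStokesRegularity.Theses.TautLoopKelvin.TautLoopLaw := by
  intro ν T hν hT u p hcl hLH hdec g hg t₁ t₂ ht₁ ht₁₂ ht₂ Φ M hΦ hM hmaj hint
  obtain ⟨hdecay, hsup⟩ := stub_tautLoopSlabRegularity ν T hν hT u p hcl hLH hdec
  have hcont : ∀ s ∈ Set.Ico 0 T, Continuous (u s) := fun s hs =>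
    (hcl.contDiff_velocity hs).continuous
  have hC2 : ∀ s ∈ Set.Ico 0 T, ContDiff ℝ 2 (u s) := fun s hs =>
    (hcl.contDiff_velocity hs).of_le (by norm_cast)
  refine stub_tautLoopDiniSaks (fun s => ℓ⟦u s, g⟧) (fun s => Λ⟦u s, g⟧) Φ t₁ t₂ M ht₁₂ hM hΦ
    (fun s hs => hmaj s hs) hint ?_ ?_
  · -- right-lower-semicontinuity of the spectrum on `[t₁, t₂)`
    intro t ht
    have htT : t ∈ Set.Ico 0 T := ⟨ht₁.trans ht.1, ht.2.trans ht₂⟩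
    have hnear : ∀ᶠ s in nhdsWithin t (Set.Ioi t), Continuous (u s) := by
      have hmem : Set.Ioo t T ∈ nhdsWithin t (Set.Ioi t) := Ioo_mem_nhdsGT htT.2
      filter_upwards [hmem] with s hs
      exact hcont s ⟨htT.1.trans hs.1.le, hs.2⟩
    exact stub_tautLoopRightLscTransfer u t g hg (hcont t htT) hnear (hsup t htT)
      (stub_tautLoopLevelLeftContinuity (u t) (hC2 t htT) (hdecay t htT) g hg)
  · -- the exact-level left-Dini step on `(t₁, t₂]`
    intro t ht η hη
    exact stub_tautLoopStepOfSelection stub_tautLoopWalkSelection ν T hν hT u p hcl hLH hdec g hg t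
      (lt_of_le_of_lt ht₁ ht.1) (lt_of_le_of_lt ht.2 ht₂) η hη

end Summit.NavierStokesRegularity.NavierStokesRegularity.Theorems

end
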